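import Summits.HodgeConjecture.HodgeConjecture.Theorems.LimitExtensionHypersurfaceHodgeFourLowDegreeRationalCurves
import Literature.AlgebraicGeometry.Motives.ChowZeroSupportedOnHyperplaneSectionOfDegreeLE

/-!
# Route LimitExtension — `HypersurfaceHodgeFourLowDegree` (item stmt-HodgeConjecture-3003), VIII:
# the quintic fourfold WITHOUT rational curves — Roitman's strong lines; the item from Prop. 10.26 alone

Helper file for the support item `HypersurfaceHodgeFourLowDegree` of route
`HodgeConjecture/LimitExtension` (`∀ d ≤ 5, ∀ X, IsSmoothHypersurface 4 d X → HodgeConjectureFor 4 X`).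
Files I–VII left the item CLOSED MODULO two named facts: Bloch–Srinivas' Prop. 10.26
(`BlochSrinivas1983_hodgeConjectureDegreeFour_of_chowZeroSupported`, Hodge-theoretic) and, for the
smooth quintic fourfold `V(5) ⊂ ℙ⁵` only, MORI'S THEOREM (rational curves through every point,
`Motives.Mori1982_rationalCurve_through_point_of_smoothHypersurface`), used to put `CH₀(V(5))` on a
hyperplane section.

This file removes Mori's theorem. The `CH₀`-input is now PROVED for every hypersurface of degree
`2 ≤ e ≤ N` in `ℙᴺ` by Roitman's technique of STRONG LINES (A. A. Roitman, Mat. Zametki 28 (1980);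
Hirschowitz–Iyer, Contemp. Math. 522 (2010), §1.3: "either they cut `Y` in a single (multiple) point
or they are inside `Y`"): through a closed point `x = [p]` of `X = V₊(F)` the projective dimension
theorem gives a line `ℓ₀` of full contact (`V₊(F) · [ℓ₀] = e [x]`) and a line `ℓ₁` of contact
`e - 1` whose residual point `[v₁]` lies on `X` and on a fixed coordinate hyperplane
(`V₊(F) · [ℓ₁] = (e-1) [x] + [v₁]`); `[ℓ₀] = [ℓ₁]` in `CH₁(ℙᴺ)` and Fulton's Cor. 2.4.1 give
`[x] = [v₁]` in `CH₀(X)` (`Motives/ChowZeroSupportedOnHyperplaneSectionOfDegreeLE`,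
`Motives/HighContactLineMultiplicity`; lines inside `X` by `Motives/LinearSubspaceSectionsRatEquiv`).
Hence:

* `limitExtension_exists_forall_isRationallyEquivalent_primeCycle_of_isSmoothHypersurface_of_two_le` —
  for a smooth complex hypersurface of degree `2 ≤ e ≤ n + 1 = N`, every closed point is rationally
  equivalent on `X` to a `0`-cycle on a fixed proper closed subset;
* `limitExtension_hasChowZeroSupportedInDimLE_three_of_isSmoothHypersurface_five_strongLines` — **a smooth
  quintic fourfold satisfies the hypothesis of Prop. 10.26 (`HasChowZeroSupportedInDimLE X 3`),
  unconditionally** (file VII had this granted Mori's theorem);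
  `limitExtension_hasChowZeroSupportedInDimLE_three_of_isSmoothHypersurface_four` — the same for every
  smooth hypersurface fourfold of degree `1 ≤ d ≤ 5`;
* `limitExtension_hypersurfaceHodgeFourLowDegree_of_blochSrinivas_only` — **THE ITEM FROM
  `BlochSrinivas1983_hodgeConjectureDegreeFour_of_chowZeroSupported` ALONE** (the only remaining named
  fact; `d ≤ 2` is moreover proved outright in files II–VI);
* `limitExtension_hodgeTwoTwo_algebraic_quarticQuinticFourfold_of_blochSrinivas` — the Conte–Murre
  named fact from Prop. 10.26 alone;
* `limitExtension_hypersurfaceHodgeFourLowDegree_of_leaves` — the item's exact leaf set on the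
  tree's current trust base, Mori removed: a Gysin / cycle-class formalism `G` on `H*(X(ℂ); ℂ)` with
  Hodge-compatible Gysin morphisms (a CONSTRUCTION the tree lacks), projective Hironaka, Prop. 9.20
  on products, and Lefschetz `(1,1)`.

No `sorry`, no definition, no new named fact.

## References

* [VoisinHodgeII2003] C. Voisin, Hodge Theory and Complex Algebraic Geometry II (CUP 2003),
  Prop. 10.26 and the remark following it (§10.2.3, p. 305 f.).
* [HirschowitzIyer2010] A. Hirschowitz, J. N. N. Iyer, Contemp. Math. 522 (2010) = arXiv:0903.5018,
  §1.3 and §6, proof of Prop. 6.2 (i) (Roitman's strong lines; text read).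
* [Roitman1980] A. A. Roitman, Rational equivalence of zero-dimensional cycles, Mat. Zametki 28
  (1980) 85–90 (cite-only).
* [Fulton1998] W. Fulton, Intersection Theory, 2nd ed. (1998), Cor. 2.4.1.
* [ConteMurre1978] A. Conte, J. P. Murre, Math. Ann. 238 (1978) 79–88 (cite-only).
-/

-- `Summit.HodgeConjecture.HodgeConjecture.Theorems` is the mandated namespace (single-problem summit:
-- Problem = Summit), which `linter.dupNamespace` flags on every declaration; the lakefile turns the
-- linter off tree-wide (weak option), restated here so stand-alone elaboration is warning-free too.
set_option linter.dupNamespace false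

noncomputable section

namespace Summit.HodgeConjecture.HodgeConjecture.Theorems

open CategoryTheory AlgebraicGeometry MonoidalCategory Order
open Literature.AlgebraicTopology.SingularHomology
open Literature.AlgebraicGeometry.HodgeTheory Literature.AlgebraicGeometry.Motives
  Literature.Barriers.HodgeConjecture Literature.AlgebraicGeometry

/-! ### `CH₀` of a smooth hypersurface of degree `≤ N` (Roitman), on the route's carriers -/

/-- **`CH₀` of a smooth complex hypersurface of degree `2 ≤ e ≤ n + 1` is supported on a hyperplane
section, point by point** (Roitman's strong lines,
`Motives.Hypersurface.exists_forall_isRationallyEquivalent_primeCycle_of_degree_le`, transported to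
`Motives.IsSmoothHypersurface n e X`: the cutting-out closed immersion `X ↪ ℙⁿ⁺¹_ℂ` with image
`V₊(F)`, `F` irreducible hence prime). Complements
`exists_forall_isRationallyEquivalent_primeCycle_of_isSmoothHypersurface` (`e ≤ n`, lines through
every point) in the boundary degree `e = n + 1`.
[cite: HirschowitzIyer2010, §1.3 and proof of Prop. 6.2 (i)] [cite: Roitman1980]
[cite: VoisinHodgeII2003, remark following Prop. 10.26 (§10.2.3)] -/
theorem limitExtension_exists_forall_isRationallyEquivalent_primeCycle_of_isSmoothHypersurface_of_two_le
    {n e : ℕ} {X : SchemeOver ℂ} (hX : IsSmoothHypersurface n e X) (he2 : 2 ≤ e) (hen : e ≤ n + 1) :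
    ∃ W : Set ↥X.left, IsClosed W ∧ W ≠ Set.univ ∧
      ∀ x : ↥X.left, height x = 0 →
        ∃ c' ∈ Motives.cyclesOfDim X.left 0, (∀ z, c' z ≠ 0 → z ∈ W) ∧
          Motives.IsRationallyEquivalent (Motives.primeCycle x) c' 0 := by
  obtain ⟨hsp, F, hF, hirr, -, i, hi, hV⟩ := hX
  haveI := hi
  haveI := hsp.smoothOfRelativeDimension
  haveI : Smooth X.hom := SmoothOfRelativeDimension.smooth n _
  haveI : LocallyOfFiniteType X.hom := inferInstance
  haveI : IsIntegral X.left := Motives.IsSmoothProjective.isIntegral_holds hsp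
  exact Hypersurface.exists_forall_isRationallyEquivalent_primeCycle_of_degree_le (d := n) i
    ((MvPolynomial.mem_homogeneousSubmodule e F).2 hF)
    (UniqueFactorizationMonoid.irreducible_iff_prime.mp hirr) hV he2 hen

/-- **A smooth quintic fourfold satisfies the hypothesis of Prop. 10.26, unconditionally**:
`CH₀(V(5))` is supported on a closed algebraic subset of dimension `≤ 3` (a hyperplane section;
`HasChowZeroSupportedInDimLE X 3`) — by Roitman's strong lines (`5 ≤ 4 + 1`), no rational curves and
no Mori's theorem (compare `limitExtension_hasChowZeroSupportedInDimLE_three_of_isSmoothHypersurface_five_of_mori`).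
[cite: VoisinHodgeII2003, Prop. 10.26 and the remark following it (§10.2.3)]
[cite: HirschowitzIyer2010, §1.3 and proof of Prop. 6.2 (i)] -/
theorem limitExtension_hasChowZeroSupportedInDimLE_three_of_isSmoothHypersurface_five_strongLines
    ⦃X : SchemeOver ℂ⦄ (hX : IsSmoothHypersurface 4 5 X) : HasChowZeroSupportedInDimLE X 3 := by
  obtain ⟨W, hW, hWu, hpt⟩ :=
    limitExtension_exists_forall_isRationallyEquivalent_primeCycle_of_isSmoothHypersurface_of_two_le hX
      (by norm_num) (by norm_num)
  exact ⟨W, chowZeroSupportedInDimLE_of_forall_point hX.1 (by norm_num) hW hWu hpt⟩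

/-- **Every smooth hypersurface fourfold of degree `1 ≤ d ≤ 5` satisfies the hypothesis of
Prop. 10.26** (`HasChowZeroSupportedInDimLE X 3`): `d ≤ 4` by lines through every point
(`hasChowZeroSupportedInDimLE_of_isSmoothHypersurface`), `2 ≤ d ≤ 5` by Roitman's strong lines.
[cite: VoisinHodgeII2003, Prop. 10.26 and the remark following it (§10.2.3)]
[cite: HirschowitzIyer2010, §1.3 and proof of Prop. 6.2 (i)] -/
theorem limitExtension_hasChowZeroSupportedInDimLE_three_of_isSmoothHypersurface_four
    ⦃d : ℕ⦄ ⦃X : SchemeOver ℂ⦄ (hd0 : 0 < d) (hd : d ≤ 5) (hX : IsSmoothHypersurface 4 d X) :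
    HasChowZeroSupportedInDimLE X 3 := by
  rcases Nat.lt_or_ge d 2 with hlt | h2
  · exact hasChowZeroSupportedInDimLE_of_isSmoothHypersurface hX hd0 (by omega)
  · obtain ⟨W, hW, hWu, hpt⟩ :=
      limitExtension_exists_forall_isRationallyEquivalent_primeCycle_of_isSmoothHypersurface_of_two_le hX
        h2 (by omega)
    exact ⟨W, chowZeroSupportedInDimLE_of_forall_point hX.1 (by norm_num) hW hWu hpt⟩

/-! ### The item from Prop. 10.26 alone -/

/-- **`HypersurfaceHodgeFourLowDegree` from Bloch–Srinivas' Prop. 10.26 ALONE.** Granted the single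
named fact `BlochSrinivas1983_hodgeConjectureDegreeFour_of_chowZeroSupported` (Voisin II,
Prop. 10.26), the Hodge conjecture holds for every smooth hypersurface fourfold of degree `d ≤ 5`:
the `CH₀`-hypothesis is a THEOREM for all `1 ≤ d ≤ 5` (lines for `d ≤ 4`, Roitman's strong lines for
the quintic), and the other codimensions and the Hodge model are theorems of the tree
(`limitExtension_hypersurfaceHodgeFourLowDegree_of_blochSrinivas`). This removes Mori's theorem from
the residue left by file VII: the item is CLOSED MODULO Prop. 10.26 only.
[cite: VoisinHodgeII2003, Prop. 10.26 and the remark following it (§10.2.3)]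
[cite: HirschowitzIyer2010, §1.3 and proof of Prop. 6.2 (i)] [cite: ConteMurre1978] -/
theorem limitExtension_hypersurfaceHodgeFourLowDegree_of_blochSrinivas_only
    (hBS : BlochSrinivas1983_hodgeConjectureDegreeFour_of_chowZeroSupported) :
    Theses.LimitExtension.HypersurfaceHodgeFourLowDegree :=
  limitExtension_hypersurfaceHodgeFourLowDegree_of_blochSrinivas hBS
    fun _ hX ↦ limitExtension_hasChowZeroSupportedInDimLE_three_of_isSmoothHypersurface_five_strongLines hX

/-- **The Conte–Murre named fact from Prop. 10.26 alone**: granted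
`BlochSrinivas1983_hodgeConjectureDegreeFour_of_chowZeroSupported`, every rational `(2,2)`-class on a
smooth quartic or quintic fourfold is algebraic (`hodgeTwoTwo_algebraic_quarticQuinticFourfold`), the
quintic `CH₀`-input being Roitman's strong lines (no Mori's theorem; compare
`limitExtension_hodgeTwoTwo_algebraic_quarticQuinticFourfold_of_blochSrinivas_of_mori`).
[cite: MurreTorino1994, Ch. V §5.3.1, Theorem ([CM 1]) and Applications]
[cite: VoisinHodgeII2003, Prop. 10.26 and the remark following it (§10.2.3)] -/
theorem limitExtension_hodgeTwoTwo_algebraic_quarticQuinticFourfold_of_blochSrinivas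
    (hBS : BlochSrinivas1983_hodgeConjectureDegreeFour_of_chowZeroSupported) :
    hodgeTwoTwo_algebraic_quarticQuinticFourfold :=
  hodgeTwoTwo_algebraic_quarticQuinticFourfold_of_blochSrinivas_of_forall_point hBS fun _ hX ↦
    limitExtension_exists_forall_isRationallyEquivalent_primeCycle_of_isSmoothHypersurface_of_two_le hX
      (by norm_num) (by norm_num)

/-! ### The item's leaf set, Mori removed -/

/-- **The exact leaf set of `HypersurfaceHodgeFourLowDegree` on the tree's current trust base, after
this file**: a Gysin / cycle-class formalism `G` on `H*(X(ℂ); ℂ)` whose Gysin morphisms are Hodge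
compatible (`G`, `hG` — a construction the tree lacks), projective Hironaka (`hH`), Prop. 9.20 on
products (`hcupA`) and Lefschetz `(1,1)` (`h11`) — the leaves of
`BlochSrinivas1983_hodgeConjectureDegreeFour_of_chowZeroSupported_of_leaves`, with the Hodge models
and the Lefschetz isomorphism of smooth projective threefolds discharged in the tree; the `CH₀`-inputs
for ALL `1 ≤ d ≤ 5` are now theorems (compare `limitExtension_hypersurfaceHodgeFourLowDegree_of_leaves_of_mori`,
which needed Mori's theorem as a fifth leaf). [cite: VoisinHodgeII2003, Prop. 10.26 and its proof (§10.2.3, p. 306)]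
[cite: VoisinHodgeI2002, Thm. 6.25 and Thm. 11.30] -/
theorem limitExtension_hypersurfaceHodgeFourLowDegree_of_leaves (G : GysinFormalism)
    (hG : G.IsGysinHodgeCompatible) (hH : Resolution.Hironaka1964_projective.{0})
    (hcupA : ∀ ⦃n m : ℕ⦄ ⦃X Y : SchemeOver ℂ⦄, IsSmoothProjective n X → IsSmoothProjective m Y →
      ∀ ⦃x : complexBetti (X ⊗ Y) (2 * 2)⦄ ⦃y : complexBetti (X ⊗ Y) (2 * m)⦄,
        x ∈ algebraicClasses (X ⊗ Y) 2 → y ∈ algebraicClasses (X ⊗ Y) m →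
          cupProduct (two_mul_add_two_mul 2 m) x y ∈ algebraicClasses (X ⊗ Y) (2 + m))
    (h11 : lefschetzOneOne_rational) :
    Theses.LimitExtension.HypersurfaceHodgeFourLowDegree :=
  limitExtension_hypersurfaceHodgeFourLowDegree_of_blochSrinivas_only
    (BlochSrinivas1983_hodgeConjectureDegreeFour_of_chowZeroSupported_of_leaves G hG hH
      (fun _ _ ↦ nonempty_hodgeModel_holds) hcupA h11
      fun Y ↦ nonempty_hardLefschetzThreefold_of_nFold (nonempty_hardLefschetzNFold_holds 3 Y))

end Summit.HodgeConjecture.HodgeConjecture.Theorems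

end
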